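import Mathlib.Analysis.SpecialFunctions.Complex.Log
import Mathlib.Topology.Algebra.Module.Equiv
import HarnessLib

/-!
# The near-resonant all-fast regime at critical size: the rescaled system (definitions)

Zilber's Exponential-Algebraic Closedness, case ladder (host summit Schanuel, cell `pub-schanuel`,
seat 2, gen 13).  Bookkeeping for the CRITICAL-SIZE family of O54 (a)

  `W_r = {x₂ = r₀x₀ + r₁x₁, y₀ = x₀ + y₂, y₁ = x₁ + y₂} ⊆ ℂ³ × ℂ³`,  `r₀ + r₁ = 1`, `r₀ ∉ ℚ`

(exponential points: `e^{xⱼ} = xⱼ + e^{x₂}`, `j = 0, 1`; for `r₀ = √2` this is the printed example of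
O53 (a), where the coupling `y₂ = e^{x₂}` has the same size as the targets `xⱼ`).  The regime:
`xⱼ = ξ + 2πi nⱼ + δⱼ`, `x₂ = ξ = log d + τ`, labels `n = (n₁ + d, n₁) ∈ ℤ²` with near-resonance
defect `ε = r₀ d + n₁`, parameters `s = 1/d`, `ℓ = log d / d`.  In the unknowns `(δ₀, δ₁, τ)` the
two equations and the hyperplane constraint become the ENTIRE system

  `e^{δⱼ} = 1 + e^{-τ} (Aⱼ + ℓ + s (B ε + τ + δⱼ))` (`j = 0,1`),   `r₀ δ₀ + r₁ δ₁ + B ε = 0`,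

`A₀ = 2πi r₁`, `A₁ = -2πi r₀`, `B = 2πi` — `nrF`.  Its partial derivative in the unknowns at a
solution with `s = ℓ = 0` is `nrL` (explicit `3 × 3`), and at `s = ℓ = 0` the constraint reads
`G̃(σ) = -2πi ε` with `σ = e^{-τ}` and `G̃ = nrG`, `G̃(σ) = r₀ Log(1 + 2πi r₁ σ) + r₁ Log(1 - 2πi r₀ σ)
= 2π² r₀ r₁ σ² + O(σ³)`.

HONEST FRAMING: bookkeeping for an existence theorem about explicit members of an OPEN cell
(`ECCell 3 2`); nothing here bears on Schanuel's conjecture; EAC ⇏ SC.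
-/

noncomputable section

open Complex

set_option linter.dupNamespace false

namespace Summit.Schanuel.Schanuel.Theorems

section NearResonant

/-- **The rescaled near-resonant system** on (parameters `(ε, s, ℓ)`) × (unknowns `(δ₀, δ₁, τ)`):
`(e^{δ₀} - 1 - e^{-τ}(A₀ + ℓ + s(Bε + τ + δ₀)), e^{δ₁} - 1 - e^{-τ}(A₁ + ℓ + s(Bε + τ + δ₁)),
r₀δ₀ + r₁δ₁ + Bε)`. (new) -/
def nrF (r₀ r₁ A₀ A₁ B : ℂ) (v : (ℂ × ℂ × ℂ) × (ℂ × ℂ × ℂ)) : ℂ × ℂ × ℂ :=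
  (exp v.2.1 - 1 - exp (-v.2.2.2) * (A₀ + v.1.2.2 + v.1.2.1 * (B * v.1.1 + v.2.2.2 + v.2.1)),
   exp v.2.2.1 - 1 - exp (-v.2.2.2) * (A₁ + v.1.2.2 + v.1.2.1 * (B * v.1.1 + v.2.2.2 + v.2.2.1)),
   r₀ * v.2.1 + r₁ * v.2.2.1 + B * v.1.1)

/-- The system at parameters `(ε, 0, 0)` (the limit `d → ∞`):
`(e^{δ₀} - 1 - e^{-τ}A₀, e^{δ₁} - 1 - e^{-τ}A₁, r₀δ₀ + r₁δ₁ + Bε)`. [folklore] -/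
theorem nrF_param_zero (r₀ r₁ A₀ A₁ B ε : ℂ) (q : ℂ × ℂ × ℂ) :
    nrF r₀ r₁ A₀ A₁ B ((ε, 0, 0), q) =
      (exp q.1 - 1 - exp (-q.2.2) * A₀, exp q.2.1 - 1 - exp (-q.2.2) * A₁,
        r₀ * q.1 + r₁ * q.2.1 + B * ε) := by
  simp [nrF]

/-- **The partial derivative of `nrF` in the unknowns** at a point with `s = ℓ = 0`, as an explicit
continuous linear map `(w₀, w₁, w₂) ↦ (e₀w₀ + c₀w₂, e₁w₁ + c₁w₂, r₀w₀ + r₁w₁)`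
(`eⱼ = e^{δⱼ}`, `cⱼ = e^{-τ}Aⱼ`). (new) -/
def nrL (e₀ e₁ c₀ c₁ r₀ r₁ : ℂ) : (ℂ × ℂ × ℂ) →L[ℂ] (ℂ × ℂ × ℂ) :=
  (e₀ • ContinuousLinearMap.fst ℂ ℂ (ℂ × ℂ) +
      c₀ • ((ContinuousLinearMap.snd ℂ ℂ ℂ).comp (ContinuousLinearMap.snd ℂ ℂ (ℂ × ℂ)))).prod
    ((e₁ • ((ContinuousLinearMap.fst ℂ ℂ ℂ).comp (ContinuousLinearMap.snd ℂ ℂ (ℂ × ℂ))) +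
        c₁ • ((ContinuousLinearMap.snd ℂ ℂ ℂ).comp (ContinuousLinearMap.snd ℂ ℂ (ℂ × ℂ)))).prod
      (r₀ • ContinuousLinearMap.fst ℂ ℂ (ℂ × ℂ) +
        r₁ • ((ContinuousLinearMap.fst ℂ ℂ ℂ).comp (ContinuousLinearMap.snd ℂ ℂ (ℂ × ℂ)))))

/-- The explicit action of `nrL`. [folklore] -/
@[simp] theorem nrL_apply (e₀ e₁ c₀ c₁ r₀ r₁ : ℂ) (w : ℂ × ℂ × ℂ) :
    nrL e₀ e₁ c₀ c₁ r₀ r₁ w =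
      (e₀ * w.1 + c₀ * w.2.2, e₁ * w.2.1 + c₁ * w.2.2, r₀ * w.1 + r₁ * w.2.1) := by
  simp [nrL]

/-- **The limit function** `G̃(σ) = r₀ Log(1 + 2πi(1 - r₀)σ) + (1 - r₀) Log(1 - 2πi r₀ σ)`:
at `s = ℓ = 0` the constraint `r₀δ₀ + r₁δ₁ = -2πiε` with `e^{δⱼ} = 1 + 2πiνⱼσ` (principal
branches, `ν = (1 - r₀, -r₀)`) reads `G̃(σ) = -2πiε`. (new) -/
def nrG (r₀ : ℝ) (σ : ℂ) : ℂ :=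
  (r₀ : ℂ) * log (1 + 2 * Real.pi * I * (1 - r₀ : ℝ) * σ) +
    ((1 - r₀ : ℝ) : ℂ) * log (1 - 2 * Real.pi * I * (r₀ : ℂ) * σ)

end NearResonant

end Summit.Schanuel.Schanuel.Theorems

end
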